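import Summits.Ventures.PercRepro.Night2LocalD2R14SixOneA

/-!
# PercRepro — the six-element columns of R1₄ with one far preimage, part B: the spreads (night-2, gen 16)

The spread of a layer-0 basis `B` is `(2/5 − keep B)/|cl B ∖ B| ≤ (σ⁺(B) − 3/5)⁺/|cl B ∖ B|`
(`two_fifths_sub_r14Keep_le`), with `σ⁺(B) ≤ 4·(6/35)` (`r14Sigma_le`).  At a six-element shadow set `S` with a far
preimage `B₀` (proofs/NIGHT-2-k1.md §7.0 (U2)):

* a basis `S ∖ {x, y}` with `x ∈ B₀` does not spread — its face `S ∖ {x, z₀}` (`z₀ ∈ B₀ ∖ {x, y}`) is not a member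
  (`G ∖ face ⊆ (cl B₀) ∖ {y}` has rank `3`);
* `|cl B ∖ B| ≥ |G ∖ S| + 1` for every basis `B = S ∖ {x, y}` (`cl B = G ∖ {y}`);

so **`r14Spread_le_of_far`**: the spread part is at most `2 · (3/35)/(|G ∖ S| + 1)`.
-/

namespace PercRepro.Shadow

open Finset PerFlat ThmH

variable {α : Type*} [DecidableEq α] {M : Matroid α} [M.Finite]

/-- `2/5 − keep(B) ≤ (σ⁺(B) − 3/5)⁺`. -/
theorem two_fifths_sub_r14Keep_le (G B : Finset α) :
    2 / 5 - r14Keep M G B ≤ max 0 (r14Sigma M G B - 3 / 5) := by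
  unfold r14Keep
  rcases le_or_gt (r14Sigma M G B) (3 / 5) with h | h
  · rw [min_eq_left (by linarith), max_eq_right (by norm_num)]
    simp
  · rcases le_or_gt (r14Sigma M G B) 1 with h1 | h1
    · rw [min_eq_right (by linarith), max_eq_right (by linarith)]
      apply le_max_of_le_right
      linarith
    · rw [min_eq_right (by linarith), max_eq_left (by linarith)]
      apply le_max_of_le_right
      linarith

open scoped Classical in
/-- `σ⁺(B) ≤ |B| · (6/35)`. -/
theorem r14Sigma_le (G B : Finset α) : r14Sigma M G B ≤ (B.card : ℚ) * (6 / 35) := by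
  unfold r14Sigma
  rw [← nsmul_eq_mul, ← Finset.sum_const]
  apply Finset.sum_le_sum
  intro z _
  split_ifs
  · exact r14Cov_le _ _
  · norm_num

open scoped Classical in
/-- A layer-0 basis `B` of a six-element shadow set `S = insert x (B ∪ {y})` has `|B| = 4`, `x ∉ B`, `x ≠ y`,
`y ∉ B`, `G ∖ cl B = {y}`. -/
theorem basis_facts_of_six {G : Finset α} (hG : G ∈ flatsQ M (4 + 1)) {y : α} (hyG : y ∈ G)
    (hyc : y ∉ clF M (G.erase y)) (hP : ∀ z ∈ G.erase y, 4 ≤ rkN M ((G.erase y).erase z)) {S B : Finset α}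
    (h6 : S.card = 6) (hBm : B ∈ membersIn M (Uq M (4 + 2) 4) G) (hm1 : (G \ clF M B).card = 1) {x : α}
    (hx : x ∈ clF M B \ B) (hSx : S = insert x (B ∪ (G \ clF M B))) :
    G \ clF M B = {y} ∧ y ∉ B ∧ x ∉ B ∧ x ≠ y ∧ B.card = 4 ∧ S = insert x (B ∪ {y}) := by
  have hBU : B ∈ Uq M (4 + 2) 4 := (mem_membersIn.1 hBm).1
  have hBG : B ⊆ G := (subset_clF hBU).trans (mem_membersIn.1 hBm).2
  have hyB : y ∉ B := by
    intro hyB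
    have := two_le_card_sdiff_clF_of_mem_coloop hG hyG hyc hP hBm hyB
    omega
  have hBy : B ⊆ G.erase y := fun e he => Finset.mem_erase.2 ⟨fun h => hyB (h ▸ he), hBG he⟩
  have hGy : G \ clF M B = {y} := sdiff_clF_eq_singleton_of_subset_erase hG hyG hyc hBm hBy
  have hxB : x ∉ B := (Finset.mem_sdiff.1 hx).2
  have hxy : x ≠ y := by
    intro h
    have hx' : x ∈ G \ clF M B := by
      rw [hGy, h]
      exact Finset.mem_singleton_self _
    exact (Finset.mem_sdiff.1 hx').2 (Finset.mem_sdiff.1 hx).1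
  rw [hGy] at hSx
  have hxBy : x ∉ B ∪ {y} := by
    rw [Finset.mem_union, Finset.mem_singleton, not_or]
    exact ⟨hxB, hxy⟩
  have hB4 : B.card = 4 := by
    have h1 : S.card = (B ∪ {y}).card + 1 := by rw [hSx, Finset.card_insert_of_notMem hxBy]
    have h2 : (B ∪ {y}).card = B.card + 1 := by
      rw [Finset.card_union_of_disjoint (Finset.disjoint_singleton_right.2 hyB), Finset.card_singleton]
    omega
  exact ⟨hGy, hyB, hxB, hxy, hB4, hSx⟩

open scoped Classical in
/-- `|cl B ∖ B| ≥ |G ∖ S| + 1` for a layer-0 basis `B` with `S = insert x (B ∪ {y})`, `S ⊆ G`. -/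
theorem card_sdiff_ge_of_basis {G : Finset α} (hG : G ∈ flatsQ M (4 + 1)) {y : α} (hyG : y ∈ G)
    (hyc : y ∉ clF M (G.erase y)) {S B : Finset α} (hSG : S ⊆ G) (hBm : B ∈ membersIn M (Uq M (4 + 2) 4) G)
    {x : α} (hxB : x ∉ B) (hxy : x ≠ y) (hyB : y ∉ B) (hSx : S = insert x (B ∪ {y})) :
    (G \ S).card + 1 ≤ (clF M B \ B).card := by
  have hGg : G ⊆ gr M := (mem_flatsQ.1 hG).1
  have hBU : B ∈ Uq M (4 + 2) 4 := (mem_membersIn.1 hBm).1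
  have hBG : B ⊆ G := (subset_clF hBU).trans (mem_membersIn.1 hBm).2
  have hBy : B ⊆ G.erase y := fun e he => Finset.mem_erase.2 ⟨fun h => hyB (h ▸ he), hBG he⟩
  -- `G ∖ {y} ⊆ cl B`
  have hcl : G.erase y ⊆ clF M B := by
    have hr := rkN_erase_eq_of_coloop hG hyG hyc
    have hrB := rkN_eq_of_mem_Uq hBU
    have h := subset_closure_of_rkN_eq (M := M) ((Finset.erase_subset _ _).trans hGg) hBy (by omega)
    intro e he
    rw [mem_clF_iff]
    exact h (Finset.mem_coe.2 he)
  have hyS : y ∈ S := by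
    rw [hSx]
    exact Finset.mem_insert_of_mem (Finset.mem_union_right _ (Finset.mem_singleton_self _))
  have hxS : x ∈ S := by rw [hSx]; exact Finset.mem_insert_self _ _
  have hsub : insert x (G \ S) ⊆ clF M B \ B := by
    intro e he
    rw [Finset.mem_insert] at he
    rw [Finset.mem_sdiff]
    rcases he with rfl | he
    · exact ⟨hcl (Finset.mem_erase.2 ⟨hxy, hSG hxS⟩), hxB⟩
    · rw [Finset.mem_sdiff] at he
      refine ⟨hcl (Finset.mem_erase.2 ⟨fun h => he.2 (h ▸ hyS), he.1⟩), ?_⟩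
      intro heB
      exact he.2 (by rw [hSx]; exact Finset.mem_insert_of_mem (Finset.mem_union_left _ heB))
  have hxGS : x ∉ G \ S := fun h => (Finset.mem_sdiff.1 h).2 hxS
  have := Finset.card_le_card hsub
  rw [Finset.card_insert_of_notMem hxGS] at this
  exact this

open scoped Classical in
/-- With a far preimage `B₀`, a basis `S ∖ {x, y}` with `x ∈ B₀` has a face that is not a member, so it keeps `2/5`. -/
theorem r14Keep_eq_of_far_of_mem {G : Finset α} (hG : G ∈ flatsQ M (4 + 1)) (hd : (gr M \ G).card = 2)
    {y : α} (hyG : y ∈ G) (hyc : y ∉ clF M (G.erase y)) {S B₀ : Finset α} (h₀ : B₀ ∈ opFarPre M G S)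
    (h6 : S.card = 6) {B : Finset α} (hGy : G \ clF M B = {y}) (hB4 : B.card = 4) {x : α} (hxB : x ∉ B)
    (hxy : x ≠ y) (hSx : S = insert x (B ∪ {y})) (hxB₀ : x ∈ B₀) : r14Keep M G B = 2 / 5 := by
  have hGg : G ⊆ gr M := (mem_flatsQ.1 hG).1
  have hB₀m := (mem_opFarPre.1 h₀).1
  have hy₀ := mem_of_mem_opFarPre hG hyG hyc h₀
  have hB₀S : B₀ ⊆ S := subset_of_mem_opFarPre h₀
  have h3 := rkN_clF_erase_eq_three hG hyG hyc hB₀m hy₀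
  -- a point `z₀ ∈ B₀ ∖ {x, y}`: `|B₀| = 4`
  have hB₀4 : B₀.card = 4 := by
    have := rkN_le_card_fin (M := M) B₀
    rw [rkN_eq_of_mem_Uq (mem_membersIn.1 hB₀m).1] at this
    have h2 := Finset.card_sdiff_add_card_eq_card hB₀S
    have hc₀ : (S \ B₀).card = 2 := by
      rw [sdiff_eq_of_mem_opFarPre h₀]; exact (mem_opFarPre.1 h₀).2.1
    omega
  obtain ⟨z₀, hz₀⟩ : ((B₀.erase y).erase x).Nonempty := by
    apply Finset.card_pos.1
    rw [Finset.card_erase_of_mem (Finset.mem_erase.2 ⟨hxy, hxB₀⟩), Finset.card_erase_of_mem hy₀, hB₀4]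
    norm_num
  rw [Finset.mem_erase, Finset.mem_erase] at hz₀
  obtain ⟨hz₀x, hz₀y, hz₀B₀⟩ := hz₀
  have hz₀S : z₀ ∈ S := hB₀S hz₀B₀
  have hz₀B : z₀ ∈ B := by
    rw [hSx, Finset.mem_insert, Finset.mem_union, Finset.mem_singleton] at hz₀S
    rcases hz₀S with h | h | h
    · exact absurd h hz₀x
    · exact h
    · exact absurd h hz₀y
  -- the face at `z₀` is not a member: `G ∖ face ⊆ (cl B₀) ∖ {y}`
  have hface : (B.erase z₀) ∪ (G \ clF M B) ∉ membersIn M (Uq M (4 + 2) 4) G := by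
    intro hmem
    have hU := (mem_membersIn.1 hmem).1
    have h6' := rkN_sdiff_eq_of_mem_Uq hU
    have hsub : G \ ((B.erase z₀) ∪ (G \ clF M B)) ⊆ (clF M B₀).erase y := by
      intro t ht
      rw [Finset.mem_sdiff, hGy, Finset.mem_union, Finset.mem_erase, Finset.mem_singleton, not_or,
        not_and] at ht
      rw [Finset.mem_erase]
      refine ⟨ht.2.2, ?_⟩
      by_cases htS : t ∈ S
      · rw [hSx, Finset.mem_insert, Finset.mem_union, Finset.mem_singleton] at htS
        rcases htS with rfl | h | h
        · exact subset_clF (mem_membersIn.1 hB₀m).1 hxB₀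
        · by_cases htz : t = z₀
          · subst htz; exact subset_clF (mem_membersIn.1 hB₀m).1 hz₀B₀
          · exact absurd h (ht.2.1 htz)
        · exact absurd h ht.2.2
      · exact sdiff_subset_clF_of_mem_opFarPre h₀ (Finset.mem_sdiff.2 ⟨ht.1, htS⟩)
    have h1 : gr M \ ((B.erase z₀) ∪ (G \ clF M B)) ⊆ (G \ ((B.erase z₀) ∪ (G \ clF M B))) ∪ (gr M \ G) := by
      intro t ht
      rw [Finset.mem_sdiff] at ht
      rw [Finset.mem_union, Finset.mem_sdiff, Finset.mem_sdiff]
      by_cases htG : t ∈ G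
      · exact Or.inl ⟨htG, ht.2⟩
      · exact Or.inr ⟨ht.1, htG⟩
    have h2 := rkN_mono (M := M) h1
    have h4 := rkN_union_le_rkN_add_card (M := M) (G \ ((B.erase z₀) ∪ (G \ clF M B))) (gr M \ G)
    have h5 := rkN_mono (M := M) hsub
    omega
  -- `σ⁺(B) ≤ 18/35`, so `keep = 2/5`
  have hsig : r14Sigma M G B ≤ 18 / 35 := by
    unfold r14Sigma
    have hterm : ∀ z ∈ B, (if (B.erase z) ∪ (G \ clF M B) ∈ membersIn M (Uq M (4 + 2) 4) G then
        r14Cov M G ((B.erase z) ∪ (G \ clF M B)) else 0) ≤ (if z = z₀ then 0 else 6 / 35) := by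
      intro z _
      by_cases hz : z = z₀
      · subst hz
        simp only [hface, if_false, if_true, le_refl]
      · simp only [hz, if_false]
        split_ifs
        · exact r14Cov_le _ _
        · norm_num
    calc ∑ z ∈ B, (if (B.erase z) ∪ (G \ clF M B) ∈ membersIn M (Uq M (4 + 2) 4) G then
          r14Cov M G ((B.erase z) ∪ (G \ clF M B)) else 0)
        ≤ ∑ z ∈ B, (if z = z₀ then (0 : ℚ) else 6 / 35) := Finset.sum_le_sum hterm
      _ = ∑ z ∈ B.erase z₀, (if z = z₀ then (0 : ℚ) else 6 / 35) := by
          rw [Finset.sum_erase]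
          simp
      _ = 18 / 35 := by
          rw [Finset.sum_congr rfl (fun z hz => if_neg (Finset.ne_of_mem_erase hz)), Finset.sum_const,
            Finset.card_erase_of_mem hz₀B, hB4]
          norm_num
  unfold r14Keep
  rw [min_eq_left (by linarith), max_eq_right (by norm_num)]

open scoped Classical in
/-- **The spread part with a far preimage** at `|S| = 6`: at most `2 · (3/35)/(|G ∖ S| + 1)`. -/
theorem r14Spread_le_of_far {G : Finset α} (hG : G ∈ flatsQ M (4 + 1)) (hd : (gr M \ G).card = 2)
    {y : α} (hyG : y ∈ G) (hyc : y ∉ clF M (G.erase y)) (hP : ∀ z ∈ G.erase y, 4 ≤ rkN M ((G.erase y).erase z))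
    {S : Finset α} (hS : S ∈ shadowAt M (4 + 2) 4 (Uq M (4 + 2) 4) G) (h6 : S.card = 6) {B₀ : Finset α}
    (h₀ : B₀ ∈ opFarPre M G S) :
    r14Spread M G S ≤ 2 * ((3 / 35) / (((G \ S).card : ℚ) + 1)) := by
  have hSG : S ⊆ G := subset_of_mem_shadowAt hS
  have hX₀ : S \ B₀ = G \ clF M B₀ := sdiff_eq_of_mem_opFarPre h₀
  have hc₀ : (S \ B₀).card = 2 := by rw [hX₀]; exact (mem_opFarPre.1 h₀).2.1
  set c : ℚ := (3 / 35) / (((G \ S).card : ℚ) + 1) with hcdef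
  have hc0 : 0 ≤ c := by positivity
  -- termwise: a basis `B` with `S = insert x (B ∪ {y})` contributes `≤ c` if `x ∈ S ∖ B₀`, else `0`
  have hterm : ∀ B ∈ (membersIn M (Uq M (4 + 2) 4) G).filter (fun B => (G \ clF M B).card = 1 ∧ ¬ 5 ≤ B.card),
      ∑ x ∈ clF M B \ B, (if S = insert x (B ∪ (G \ clF M B)) then
        (2 / 5 - r14Keep M G B) / ((clF M B \ B).card : ℚ) else 0) ≤
      (if ∃ x ∈ S \ B₀, S = insert x (B ∪ (G \ clF M B)) then c else 0) := by
    intro B hB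
    rw [Finset.mem_filter] at hB
    obtain ⟨hBm, hm1, hB5⟩ := hB
    -- each summand is `≤ (if x ∈ S ∖ B₀ ∧ S = … then c else 0)`
    have hpt : ∀ x ∈ clF M B \ B, (if S = insert x (B ∪ (G \ clF M B)) then
        (2 / 5 - r14Keep M G B) / ((clF M B \ B).card : ℚ) else 0) ≤
        (if x ∈ S \ B₀ ∧ S = insert x (B ∪ (G \ clF M B)) then c else 0) := by
      intro x hx
      by_cases hSx : S = insert x (B ∪ (G \ clF M B))
      · obtain ⟨hGy, hyB, hxB, hxy, hB4, hSx'⟩ := basis_facts_of_six hG hyG hyc hP h6 hBm hm1 hx hSx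
        rw [if_pos hSx]
        by_cases hxX : x ∈ S \ B₀
        · rw [if_pos ⟨hxX, hSx⟩]
          have hk := two_fifths_sub_r14Keep_le (M := M) G B
          have hs := r14Sigma_le (M := M) G B
          rw [hB4] at hs
          have hcard := card_sdiff_ge_of_basis hG hyG hyc hSG hBm hxB hxy hyB hSx'
          have hcpos : (0 : ℚ) < ((clF M B \ B).card : ℚ) := by
            have : 0 < (clF M B \ B).card := by omega
            exact_mod_cast this
          have hnum : 2 / 5 - r14Keep M G B ≤ 3 / 35 := by
            have : max 0 (r14Sigma M G B - 3 / 5) ≤ 3 / 35 := max_le (by norm_num) (by linarith)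
            linarith
          have hnum0 : 0 ≤ 2 / 5 - r14Keep M G B := by linarith [r14Keep_le (M := M) G B]
          rw [hcdef, div_le_div_iff₀ hcpos (by positivity)]
          have hcq : ((G \ S).card : ℚ) + 1 ≤ ((clF M B \ B).card : ℚ) := by exact_mod_cast hcard
          nlinarith
        · rw [if_neg (fun h => hxX h.1)]
          have hxB₀ : x ∈ B₀ := by
            by_contra h
            exact hxX (Finset.mem_sdiff.2 ⟨by rw [hSx']; exact Finset.mem_insert_self _ _, h⟩)
          rw [r14Keep_eq_of_far_of_mem hG hd hyG hyc h₀ h6 hGy hB4 hxB hxy hSx' hxB₀, sub_self, zero_div]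
      · rw [if_neg hSx, if_neg (fun h => hSx h.2)]
    calc ∑ x ∈ clF M B \ B, (if S = insert x (B ∪ (G \ clF M B)) then
          (2 / 5 - r14Keep M G B) / ((clF M B \ B).card : ℚ) else 0)
        ≤ ∑ x ∈ clF M B \ B, (if x ∈ S \ B₀ ∧ S = insert x (B ∪ (G \ clF M B)) then c else 0) :=
          Finset.sum_le_sum hpt
      _ ≤ (if ∃ x ∈ S \ B₀, S = insert x (B ∪ (G \ clF M B)) then c else 0) := by
          rw [← Finset.sum_filter]
          -- at most one `x` qualifies
          have hle : ((clF M B \ B).filter (fun x => x ∈ S \ B₀ ∧ S = insert x (B ∪ (G \ clF M B)))).card ≤ 1 := by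
            rw [Finset.card_le_one]
            intro x hx x' hx'
            rw [Finset.mem_filter] at hx hx'
            have h1 : x ∉ B ∪ (G \ clF M B) := by
              rw [Finset.mem_union, not_or]
              exact ⟨(Finset.mem_sdiff.1 hx.1).2, fun h => (Finset.mem_sdiff.1 h).2 (Finset.mem_sdiff.1 hx.1).1⟩
            have h2 : x' ∈ insert x (B ∪ (G \ clF M B)) := by rw [← hx.2.2, hx'.2.2]; exact Finset.mem_insert_self _ _
            rw [Finset.mem_insert] at h2
            rcases h2 with h | h
            · exact h.symm
            · exfalso
              rw [Finset.mem_union] at h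
              rcases h with h | h
              · exact (Finset.mem_sdiff.1 hx'.1).2 h
              · exact (Finset.mem_sdiff.1 h).2 (Finset.mem_sdiff.1 hx'.1).1
          rw [Finset.sum_const, nsmul_eq_mul]
          split_ifs with hex
          · have : (((clF M B \ B).filter (fun x => x ∈ S \ B₀ ∧ S = insert x (B ∪ (G \ clF M B)))).card : ℚ) ≤ 1 := by
              exact_mod_cast hle
            nlinarith
          · have hempty : (clF M B \ B).filter (fun x => x ∈ S \ B₀ ∧ S = insert x (B ∪ (G \ clF M B))) = ∅ := by
              rw [Finset.filter_eq_empty_iff]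
              intro x _ hx
              exact hex ⟨x, hx.1, hx.2⟩
            rw [hempty, Finset.card_empty]
            simp
  unfold r14Spread
  calc ∑ B ∈ (membersIn M (Uq M (4 + 2) 4) G).filter (fun B => (G \ clF M B).card = 1 ∧ ¬ 5 ≤ B.card),
        ∑ x ∈ clF M B \ B, (if S = insert x (B ∪ (G \ clF M B)) then
          (2 / 5 - r14Keep M G B) / ((clF M B \ B).card : ℚ) else 0)
      ≤ ∑ B ∈ (membersIn M (Uq M (4 + 2) 4) G).filter (fun B => (G \ clF M B).card = 1 ∧ ¬ 5 ≤ B.card),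
        (if ∃ x ∈ S \ B₀, S = insert x (B ∪ (G \ clF M B)) then c else 0) := Finset.sum_le_sum hterm
    _ ≤ 2 * c := by
        rw [← Finset.sum_filter, Finset.sum_const, nsmul_eq_mul]
        -- the qualifying bases are determined by `x ∈ S ∖ B₀`: at most two
        have hle : (((membersIn M (Uq M (4 + 2) 4) G).filter (fun B => (G \ clF M B).card = 1 ∧ ¬ 5 ≤ B.card)).filter
            (fun B => ∃ x ∈ S \ B₀, S = insert x (B ∪ (G \ clF M B)))).card ≤ 2 := by
          have hmaps : ∀ B ∈ ((membersIn M (Uq M (4 + 2) 4) G).filter (fun B => (G \ clF M B).card = 1 ∧ ¬ 5 ≤ B.card)).filter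
              (fun B => ∃ x ∈ S \ B₀, S = insert x (B ∪ (G \ clF M B))), S \ (B ∪ {y}) ∈ Finset.powersetCard 1 (S \ B₀) := by
            intro B hB
            rw [Finset.mem_filter, Finset.mem_filter] at hB
            obtain ⟨⟨hBm, hm1, hB5⟩, x, hxX, hSx⟩ := hB
            have hxcl : x ∈ clF M B \ B := by
              have hGy : G \ clF M B = {y} := by
                have hBU : B ∈ Uq M (4 + 2) 4 := (mem_membersIn.1 hBm).1
                have hBG : B ⊆ G := (subset_clF hBU).trans (mem_membersIn.1 hBm).2
                have hyB : y ∉ B := by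
                  intro hyB
                  have := two_le_card_sdiff_clF_of_mem_coloop hG hyG hyc hP hBm hyB
                  omega
                exact sdiff_clF_eq_singleton_of_subset_erase hG hyG hyc hBm
                  (fun e he => Finset.mem_erase.2 ⟨fun h => hyB (h ▸ he), hBG he⟩)
              rw [hGy] at hSx
              have hxS : x ∈ S := by rw [hSx]; exact Finset.mem_insert_self _ _
              have hxG : x ∈ G := hSG hxS
              rw [Finset.mem_sdiff]
              refine ⟨?_, ?_⟩
              · by_contra h
                have : x ∈ G \ clF M B := Finset.mem_sdiff.2 ⟨hxG, h⟩
                rw [hGy, Finset.mem_singleton] at this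
                subst this
                -- `y = x`: then `S = insert x (B ∪ {x})` has `|S| = |B| + 1 ≤ 5`
                have h1 : S = insert x B := by rw [hSx]; ext e; simp
                have := Finset.card_insert_le x B
                rw [← h1] at this
                omega
              · intro hxB
                have h1 : S = B ∪ {y} := by
                  rw [hSx]
                  exact Finset.insert_eq_of_mem (Finset.mem_union_left _ hxB)
                have := Finset.card_union_le B {y}
                rw [← h1, Finset.card_singleton] at this
                omega
            obtain ⟨hGy, hyB, hxB, hxy, hB4, hSx'⟩ := basis_facts_of_six hG hyG hyc hP h6 hBm hm1 hxcl hSx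
            rw [Finset.mem_powersetCard]
            have heq : S \ (B ∪ {y}) = {x} := by
              rw [hSx', Finset.insert_sdiff_of_notMem _ (by
                rw [Finset.mem_union, Finset.mem_singleton, not_or]; exact ⟨hxB, hxy⟩), Finset.sdiff_self,
                Finset.insert_empty]
            rw [heq]
            exact ⟨Finset.singleton_subset_iff.2 hxX, Finset.card_singleton _⟩
          have hinj : Set.InjOn (fun B => S \ (B ∪ {y}))
              ((((membersIn M (Uq M (4 + 2) 4) G).filter (fun B => (G \ clF M B).card = 1 ∧ ¬ 5 ≤ B.card)).filter
                (fun B => ∃ x ∈ S \ B₀, S = insert x (B ∪ (G \ clF M B)))) : Set (Finset α)) := by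
            intro B hB B' hB' h
            rw [Finset.mem_coe, Finset.mem_filter, Finset.mem_filter] at hB hB'
            have key : ∀ B'' : Finset α, B'' ∈ membersIn M (Uq M (4 + 2) 4) G → (G \ clF M B'').card = 1 →
                (∃ x ∈ S \ B₀, S = insert x (B'' ∪ (G \ clF M B''))) → B'' = (S.erase y) \ (S \ (B'' ∪ {y})) := by
              intro B'' hBm hm1 hex
              obtain ⟨x, -, hSx⟩ := hex
              have hyB : y ∉ B'' := by
                intro hyB
                have := two_le_card_sdiff_clF_of_mem_coloop hG hyG hyc hP hBm hyB
                omega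
              have hBS : B'' ⊆ S := by
                rw [hSx]; exact Finset.subset_union_left.trans (Finset.subset_insert _ _)
              ext e
              constructor
              · intro he
                rw [Finset.mem_sdiff, Finset.mem_erase, Finset.mem_sdiff, not_and, not_not]
                exact ⟨⟨fun h => hyB (h ▸ he), hBS he⟩, fun _ => Finset.mem_union_left _ he⟩
              · intro he
                rw [Finset.mem_sdiff, Finset.mem_erase, Finset.mem_sdiff, not_and, not_not] at he
                rcases Finset.mem_union.1 (he.2 he.1.2) with h | h
                · exact h
                · exact absurd (Finset.mem_singleton.1 h) he.1.1
            have e1 := key B hB.1.1 hB.1.2.1 hB.2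
            have e2 := key B' hB'.1.1 hB'.1.2.1 hB'.2
            have h' : S \ (B ∪ {y}) = S \ (B' ∪ {y}) := h
            rw [e1, e2, h']
          have h1 := Finset.card_le_card_of_injOn (fun B => S \ (B ∪ {y})) hmaps hinj
          rw [Finset.card_powersetCard, hc₀] at h1
          simpa using h1
        have : ((((membersIn M (Uq M (4 + 2) 4) G).filter (fun B => (G \ clF M B).card = 1 ∧ ¬ 5 ≤ B.card)).filter
            (fun B => ∃ x ∈ S \ B₀, S = insert x (B ∪ (G \ clF M B)))).card : ℚ) ≤ 2 := by exact_mod_cast hle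
        nlinarith

end PercRepro.Shadow
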